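import Mathlib.Algebra.Group.Subgroup.Map
import Mathlib.Algebra.Group.End
import HarnessLib

/-!
# Conjugacy indeterminacies of a triple `J ⊆ H ⊆ G` ([IUTchI] Remark 4.5.1) — abc-iut cell, layer L5

Mochizuki, *Inter-universal Teichmüller theory I*, §4 (kurims May-2020 manuscript), Remark 4.5.1 pp. 108–111:
pure group theory about subgroups `J ⊆ H ⊆ G` each "only known up to conjugacy in `G`".

* (i) p. 108–109: `H^g := g·H·g⁻¹` (`conjSubgroup`); an outer homomorphism `J → H` "compatible with the
  structure morphisms `J ↪ G`, `H ↪ G`" is conjugation by some `g` with `J^g ⊆ H`, so "this collection of outer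
  homomorphisms amounts to the collection of inclusions `J^{g₁} ↪ H^{g₂}`" (`outerFactorization_iff`, PROVED);
  "the abstract pairs `(H, J)` and `(H, J^g)` need not be isomorphic" (`PairsNeedNotBeIso`, stated);
* (ii) p. 109–110: the conditions `(∗⊆)`, `(∗≅)`, `(∗⊇)` on a subgroup `I` (`CondSub`, `CondIso`, `CondSup`) —
  `(∗⊆)` visibly does not mention the datum `H*`, `(∗≅)` does ("depends, in an essential fashion, on `H*`");
* (iii)–(iv) p. 110: the rigidity properties that Cor. 2.5 (at `v ∈ 𝕍^bad`) and Cor. 2.8 (at `v ∈ 𝕍^arc`)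
  supply for the triple (`π₁(𝒟^⊚)`, image of `π₁(𝒟_{v_j})`, cuspidal inertia) of Example 4.5 (i), as ABSTRACT
  predicates (`FactorizationRigid`, `ImageRigid`); that those triples satisfy them is Cor. 2.5 / 2.8
  (layer L5-t1's items) and is not asserted here; (v) p. 110–111 is expository.

Record-only; [claim: Mochizuki2012, status: disputed]; nothing here takes a side.
-/

namespace Literature.IUT.HodgeTheaters

namespace Rmk451

variable {G : Type*} [Group G]

/-- Remark 4.5.1 (i): `H^g := g · H · g⁻¹`. [claim: Mochizuki2012, status: disputed] -/
def conjSubgroup (H : Subgroup G) (g : G) : Subgroup G := H.map (MulAut.conj g).toMonoidHom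

/-- **Remark 4.5.1 (i)** ([IUTchI] p. 108–109): an outer homomorphism `J → H` "compatible with the structure
morphisms `J ↪ G`, `H ↪ G`" is conjugation by some `g ∈ G` with `J^g ⊆ H`; so "this collection of outer
homomorphisms amounts to the collection of inclusions `J^{g₁} ↪ H^{g₂}`". Precisely: `g` conjugates `J` into
`H` iff there is a homomorphism `J → H` which, composed with `H ↪ G`, is the restriction of conjugation by
`g`. [claim: Mochizuki2012, status: disputed] -/
theorem outerFactorization_iff (J H : Subgroup G) (g : G) :
    conjSubgroup J g ≤ H ↔ ∃ φ : J →* H, ∀ x : J, ((φ x : H) : G) = g * x * g⁻¹ := by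
  constructor
  · intro h
    have hmem : ∀ x : J, g * x * g⁻¹ ∈ H := fun x => h ⟨x, x.2, rfl⟩
    refine ⟨{ toFun := fun x => ⟨g * x * g⁻¹, hmem x⟩, map_one' := ?_, map_mul' := ?_ }, fun x => rfl⟩
    · ext; simp
    · intro x y; ext; simp [mul_assoc]
  · rintro ⟨φ, hφ⟩ y ⟨x, hx, rfl⟩
    have := (φ ⟨x, hx⟩).2
    rw [hφ ⟨x, hx⟩] at this
    exact this

/-- **Remark 4.5.1 (i)**, the phenomenon: "the abstract pairs `(H, J)` and `(H, J^g)` need not be isomorphic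
[i.e., it is not even necessarily the case that there exists an automorphism of `H` that maps `J` onto `J^g`]"
— the Prop asserting this can happen (e.g. `D₈ ⊆ 𝔖₄` with `J` a non-central reflection subgroup conjugate in
`𝔖₄` into the centre); recorded as a statement. [claim: Mochizuki2012, status: disputed] -/
def PairsNeedNotBeIso : Prop :=
  ∃ (G : Type) (_ : Group G) (H J : Subgroup G) (g : G), J ≤ H ∧ conjSubgroup J g ≤ H ∧
    ¬ ∃ σ : H ≃* H, (J.subgroupOf H).map σ.toMonoidHom = (conjSubgroup J g).subgroupOf H

/-- **Remark 4.5.1 (ii)**, condition `(∗⊆)` on a subgroup `I ⊆ H*`: "`I` be a `G`-conjugate of `J`" —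
"independent of the datum `H*`". [claim: Mochizuki2012, status: disputed] -/
def CondSub (J I : Subgroup G) : Prop := ∃ g : G, I = conjSubgroup J g

/-- **Remark 4.5.1 (ii)**, condition `(∗≅)` on `I ⊆ H*`: "`I` be a `G`-conjugate of `J` such that
`(H*, I) ≅ (H, J)`" [an isomorphism of pairs of a group and a subgroup] — "depends, in an essential fashion,
on the datum `H*`". [claim: Mochizuki2012, status: disputed] -/
def CondIso (H J Hstar I : Subgroup G) : Prop :=
  (∃ g : G, I = conjSubgroup J g) ∧
    ∃ σ : Hstar ≃* H, (I.subgroupOf Hstar).map σ.toMonoidHom = J.subgroupOf H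

/-- **Remark 4.5.1 (ii)**, condition `(∗⊇)` on a subgroup `I ⊇ J*` ("by reversing the direction of the
inclusion"): "`I` be a `G`-conjugate of `H`". [claim: Mochizuki2012, status: disputed] -/
def CondSup (H I : Subgroup G) : Prop := ∃ g : G, I = conjSubgroup H g

/-- **Remark 4.5.1 (iii)** ([IUTchI] p. 110), the rigidity at `v ∈ 𝕍^bad` (`G = π₁(𝒟^⊚)`, `H =` the image of
`π₁(𝒟_{v_j})`, `J =` the unique index-`l` open subgroup of a cuspidal inertia group), supplied by Cor. 2.5:
"a factorization `J ↪ H ↪ G` is uniquely determined by the composite `J ↪ G`" — a `G`-conjugate of `J` lying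
in `H` is an `H`-conjugate of `J`, and a `G`-conjugate of `H` containing `J` is `H`. As an abstract predicate
on the triple; that the triple of Example 4.5 (i) satisfies it is Cor. 2.5 (layer L5-t1), not asserted here.
[claim: Mochizuki2012, status: disputed] -/
def FactorizationRigid (H J : Subgroup G) : Prop :=
  (∀ g : G, conjSubgroup J g ≤ H → ∃ h ∈ H, conjSubgroup J g = conjSubgroup J h) ∧
    ∀ g : G, J ≤ conjSubgroup H g → conjSubgroup H g = H

/-- **Remark 4.5.1 (iv)** ([IUTchI] p. 110), the weaker rigidity at `v ∈ 𝕍^arc` supplied by Cor. 2.8: "the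
`H`-conjugacy class of the image of `J` via the arrow `J ↪ H` that occurs in such a factorization is uniquely
determined" (while the factorization itself need not be, Rem. 2.6.1). [claim: Mochizuki2012, status: disputed] -/
def ImageRigid (H J : Subgroup G) : Prop :=
  ∀ g : G, conjSubgroup J g ≤ H → ∃ h ∈ H, conjSubgroup J g = conjSubgroup J h

/-- (iii) ⇒ (iv): factorization-rigidity implies image-rigidity (Rem. 4.5.1 (v): "the property observed at
`v ∈ 𝕍^arc` in (iv) is somewhat weaker than the rather strong property observed at `v ∈ 𝕍^bad` in (iii)").
[claim: Mochizuki2012, status: disputed] -/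
theorem FactorizationRigid.imageRigid {H J : Subgroup G} (h : FactorizationRigid H J) : ImageRigid H J := h.1

end Rmk451

end Literature.IUT.HodgeTheaters
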